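import Summits.PneNP.PneNP.Theorems.ExpanderLinearGeneratorsNoPolyBoundedProofSystem
import Literature.Computability.Complexity.ScaledKannanDiagonal
import Literature.Computability.Complexity.ExpTimeMaps
import Literature.Computability.Complexity.UnaryBricks
import Literature.Computability.Complexity.StackBricksStrings
import Literature.Computability.Complexity.PairProjections
import Literature.Computability.Complexity.BranchingFn

/-!
# Crux `ProofcplxThesis` / `NoPolyBoundedProofSystem` (item `stmt-PneNP-0097`), line `Sketch`:
# the quarter-exponential padding map is computable in time `2^{O(n)}`

Stub `quarterPad_mem_FE` of the bootstrap composition (`NP = coNP ⟹` a `2^{Ω(n)}`-hard language in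
`NE ∩ coNE`, read off Kannan's diagonal language `Kannan.lang 0` at the padded input): the padding
map `y ↦ Kannan.pad (N |y|) y = y 0^{N(|y|) - |y|}` at the quarter-exponential scale
`N(n) = 2^{⌊⌊n/2⌋/2⌋+2} + ⌊⌊n/2⌋/2⌋ + 3` lies in `FE = ⋃_c FTIME(2^{cn})` (`ExpTimeMaps.lean`).

Nothing is programmed: the map is the composite of library maps
`fst ∘ padTakeFn ∘ mapFstFn (expPad 1 ∘ cons 1 ∘ cons 1 ∘ halfFn ∘ halfFn) ∘ copyFn`
(`quarterPad_eq_comp`) — copy `y ↦ ⟨y, y⟩`, replace the first copy by the exponential pad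
`1^{2^{h+2}} 0 1^{h+2}` of length exactly `N(|y|)` (`h = ⌊⌊|y|/2⌋/2⌋`, two halvings and two `cons`),
then take the first `N(|y|)` symbols of `y` with default `0` (`padTakeFn`), which is `y 0^{N-|y|}`
because `|y| ≤ N(|y|)` (`le_quarterScale`). Membership in `FE` is the closure algebra of
`ExpTimeMaps.lean` (`comp_mem_FE_of_linear`, `mapFstFn_mem_FE`, `comp_mem_FE`), exactly as for
the linear-exponential pad `lpad_mem_FE` there.

Sources: R. Kannan, *Circuit-size lower bounds and non-reducibility to sparse sets*, Inform.
Control 55 (1982), Lemma 2 (the padded strings `x 0…0`); S. Arora, B. Barak, *Computational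
Complexity: A Modern Approach*, CUP 2009, §1.3 (Claim 1.6, composition of running times), §2.6.2.
-/

set_option linter.dupNamespace false -- `Summit.PneNP.PneNP.…`: summit = sub-problem name (D-0017 single-conjunct layout)

namespace Summit.PneNP.PneNP.Theorems.Bootstrap

open Filter
open Literature.Computability.Complexity Literature.Computability.MetaComplexity
open Summit.PneNP.PneNP.Theses

/-! ### List and arithmetic helpers -/

/-- `takeD` past the end of a list pads with the default symbol: for `|l| ≤ n`,
`takeD n l a = l a^{n - |l|}`. [folklore] -/
theorem takeD_of_length_le {l : List Bool} {n : ℕ} (h : l.length ≤ n) (a : Bool) :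
    List.takeD n l a = l ++ List.replicate (n - l.length) a := by
  induction l generalizing n with
  | nil => simp
  | cons b l ih =>
    cases n with
    | zero => simp at h
    | succ n =>
      have h' : l.length ≤ n := by simpa using h
      simp [ih h']

/-- The quarter-exponential scale dominates the length: `n ≤ 2^{⌊⌊n/2⌋/2⌋+2} + ⌊⌊n/2⌋/2⌋ + 3`
(indeed `n ≤ 4h + 3 < 4 · 2^h = 2^{h+2}` for `h = ⌊⌊n/2⌋/2⌋`). [folklore] -/
theorem le_quarterScale (n : ℕ) : n ≤ 2 ^ (n / 2 / 2 + 2) + (n / 2 / 2 + 2) + 1 := by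
  have h1 : n / 2 / 2 < 2 ^ (n / 2 / 2) := Nat.lt_two_pow_self
  have h2 : 2 ^ (n / 2 / 2 + 2) = 2 ^ (n / 2 / 2) * 4 := by rw [pow_add]; norm_num
  omega

/-! ### The padding map as a composite of library maps -/

/-- The scale word `G y = 1 1 ∘ halfFn (halfFn y) = 1^{⌊⌊|y|/2⌋/2⌋ + 2}` has length
`⌊⌊|y|/2⌋/2⌋ + 2`. [folklore] -/
theorem length_quarterWord (w : List Bool) :
    ((List.cons true ∘ List.cons true ∘ Brick.halfFn ∘ Brick.halfFn) w).length =
      w.length / 2 / 2 + 2 := by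
  simp only [Function.comp_apply, List.length_cons, Brick.length_halfFn]

/-- The exponential pad of the scale word has length exactly `N(|y|) = 2^{h+2} + (h+2) + 1`,
`h = ⌊⌊|y|/2⌋/2⌋`. [folklore] -/
theorem length_expPad_quarterWord (w : List Bool) :
    ((expPad 1 ∘ (List.cons true ∘ List.cons true ∘ Brick.halfFn ∘ Brick.halfFn)) w).length =
      2 ^ (w.length / 2 / 2 + 2) + (w.length / 2 / 2 + 2) + 1 := by
  rw [Function.comp_apply, length_expPad, length_quarterWord, pow_one]

/-- The scale word map is in `FP` (two halvings, two `cons`).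
[cite: AroraBarakCC2009, §1.3 (Claim 1.6)] -/
theorem quarterWord_mem_FP :
    (List.cons true ∘ List.cons true ∘ Brick.halfFn ∘ Brick.halfFn : List Bool → List Bool) ∈ FP :=
  comp_mem_FP (cons_mem_FP true) (comp_mem_FP (cons_mem_FP true)
    (comp_mem_FP Brick.halfFn_mem_FP Brick.halfFn_mem_FP))

/-- The exponential pad of the scale word, `y ↦ 1^{2^{h+2}} 0 1^{h+2}`, is in `FE`
(`expPad 1 ∈ FE` after an `FP` map with linearly bounded output).
[cite: AroraBarakCC2009, §1.3 (Claim 1.6)] -/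
theorem expPad_quarterWord_mem_FE :
    expPad 1 ∘ (List.cons true ∘ List.cons true ∘ Brick.halfFn ∘ Brick.halfFn) ∈ FE :=
  comp_mem_FE_of_linear expPad_one_mem_FE quarterWord_mem_FP 2 fun w => by
    rw [length_quarterWord]; omega

/-- **The padding map as a composite of library maps**: copy, exponentially pad the first copy to
length `N(|y|)`, then `padTakeFn` and the first projection give `y 0^{N(|y|) - |y|}`. [folklore] -/
theorem quarterPad_eq_comp :
    (fun y : List Bool => Kannan.pad (2 ^ (y.length / 2 / 2 + 2) + (y.length / 2 / 2 + 2) + 1) y) =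
      ((fun z => (boolUnpair z).1) ∘ Brick.padTakeFn) ∘
        (mapFstFn (expPad 1 ∘ (List.cons true ∘ List.cons true ∘ Brick.halfFn ∘ Brick.halfFn)) ∘
          copyFn) := by
  funext y
  have hlen := length_expPad_quarterWord y
  simp only [Function.comp_apply] at hlen
  simp only [Function.comp_apply, copyFn_apply, mapFstFn_boolPair, Brick.padTakeFn_boolPair,
    boolUnpair_boolPair, hlen]
  rw [takeD_of_length_le (le_quarterScale y.length)]
  rfl

/-! ### The stub -/

/-- **The quarter-exponential padding `y ↦ y 0^{N(|y|)-|y|}`,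
`N(n) = 2^{⌊⌊n/2⌋/2⌋+2} + ⌊⌊n/2⌋/2⌋ + 3`, is computable in time `2^{O(n)}` (`FE`)**: by
`quarterPad_eq_comp` it is an `FP` map after `mapFstFn` of an `FE` map after the copy map
(output length `3|y| + 2`). [cite: Kannan1982, Lemma 2] -/
theorem quarterPad_mem_FE :
    (fun y : List Bool => Kannan.pad (2 ^ (y.length / 2 / 2 + 2) + (y.length / 2 / 2 + 2) + 1) y) ∈ FE := by
  rw [quarterPad_eq_comp]
  refine comp_mem_FE (comp_mem_FP boolUnpairFst_mem_FP Brick.padTakeFn_mem_FP)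
    (comp_mem_FE_of_linear (mapFstFn_mem_FE expPad_quarterWord_mem_FE) copyFn_mem_FP 3 fun w => ?_)
  rw [copyFn_apply, length_boolPair]
  omega

end Summit.PneNP.PneNP.Theorems.Bootstrap
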